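import Summits.AtomisticToContinuum.Crystallization.Theorems.OverbindingBudgetAffineBarlowNorm

/-!
# OverbindingBudget — the reference TWO SHELLS and the NEAREST DISTANCE of a chart are FINITE WINDOW DATA
# (decomp-a2c lens-4, generation 65 addendum; support for the Z2 table and the pattern-map leaf `PatternRigid` of `…FarCoreWindows` §8)

Imports ONLY `…Theorems.OverbindingBudgetAffineBarlowNorm` (tree).  PROVED, 0 sorry:
* `centreShell`, `firstShellLayer k o`, `secondShellLayer k o`, `firstShellIdx op om` (12 index triples), `secondShellIdx op om` (6), `twoShellIdx` (18):
  the index triples `(k, i, j)` of the structure points of norm `1` resp. `√2`, as functions of the two labels `op = ℓ(1) = s 0`, `om = ℓ(−1) = −s(−1)`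
  (so of the sign WINDOW only); `idxPos s t = barlowPos 1 √(2/3) s k i j`.
* `intNormSq op om t` — the integer `3‖p‖²` on layers `|k| ≤ 1`; `threeNormSq_eq_intNormSq`; `decide`d values `3` on the first shell, `6` on the second.
* ★ `mem_twoShellIdx_of_threeNormSq_le_six` — every nonzero index triple with `3‖p‖² ≤ 6` is one of the 18 (integer case analysis);
  ★ `mem_twoShellRef_iff` — `p ∈ twoShellRef s ↔ p = idxPos s t` for some `t ∈ twoShellIdx (s 0) (−s(−1))`;
  ★ `norm_barlowPos_eq_one_iff_firstShell` — `‖barlowPos … k i j‖ = 1 ↔ (k,i,j) ∈ firstShellIdx (s 0) (−s(−1))`.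
* ★ `nearest_iff_firstShell` — for `X` within `m ≤ 1/6` of a linear isometry, "`μ` is the attained minimum of `‖X p‖` over the nonzero structure points"
  is equivalent to "`μ` is the attained minimum of `‖X (idxPos s t)‖` over the 12 first-shell triples" (`norm_map_first_shell_le`: first shell wins).
-/

namespace Summit.AtomisticToContinuum.Crystallization.Theorems.OverbindingBudgetAffineFarSmoothSplit

open scoped BigOperators
open Literature.MathematicalPhysics.StatisticalMechanics

local notation "E3" => EuclideanSpace ℝ (Fin 3)

/-- `ℓ(1) = s 0` (private copy: the one-liner exists far away in the tree under another line's namespace). [this file] -/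
private theorem haggLabel_one_eq (s : ℤ → ℤ) : haggLabel s 1 = s 0 := by simpa using haggLabel_succ s 0

/-- `ℓ(−1) = −s(−1)` (private copy, same reason). [this file] -/
private theorem haggLabel_neg_one_eq (s : ℤ → ℤ) : haggLabel s (-1) = -s (-1) := by
  have h := haggLabel_succ s (-1)
  simp at h
  linarith

/-! ## The index sets -/

/-- The six first-shell index triples of the centre layer. -/
def centreShell : Finset (ℤ × ℤ × ℤ) := {(0, 1, 0), (0, 0, 1), (0, -1, 0), (0, 0, -1), (0, 1, -1), (0, -1, 1)}

/-- The three first-shell index triples of the adjacent layer `k` with lateral label `o = ±1`. -/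
def firstShellLayer (k o : ℤ) : Finset (ℤ × ℤ × ℤ) :=
  if o = 1 then {(k, 0, 0), (k, -1, 0), (k, 0, -1)} else {(k, 0, 0), (k, 1, 0), (k, 0, 1)}

/-- The three second-shell (norm `√2`) index triples of the adjacent layer `k` with lateral label `o = ±1`. -/
def secondShellLayer (k o : ℤ) : Finset (ℤ × ℤ × ℤ) :=
  if o = 1 then {(k, 1, -1), (k, -1, 1), (k, -1, -1)} else {(k, 1, -1), (k, -1, 1), (k, 1, 1)}

/-- The 12 FIRST-SHELL index triples, given the labels `op = ℓ(1)`, `om = ℓ(−1)`. -/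
def firstShellIdx (op om : ℤ) : Finset (ℤ × ℤ × ℤ) := centreShell ∪ firstShellLayer 1 op ∪ firstShellLayer (-1) om

/-- The 6 SECOND-SHELL index triples. -/
def secondShellIdx (op om : ℤ) : Finset (ℤ × ℤ × ℤ) := secondShellLayer 1 op ∪ secondShellLayer (-1) om

/-- The 18 TWO-SHELL index triples. -/
def twoShellIdx (op om : ℤ) : Finset (ℤ × ℤ × ℤ) := firstShellIdx op om ∪ secondShellIdx op om

/-- The structure point of an index triple. -/
noncomputable def idxPos (s : ℤ → ℤ) (t : ℤ × ℤ × ℤ) : E3 := barlowPos 1 (Real.sqrt (2 / 3)) s t.1 t.2.1 t.2.2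

/-- The integer `3‖p‖²` of an index triple on the layers `|k| ≤ 1`, as a function of the two labels. -/
def intNormSq (op om : ℤ) (t : ℤ × ℤ × ℤ) : ℤ :=
  3 * (t.2.1 * t.2.1 + t.2.1 * t.2.2 + t.2.2 * t.2.2) + 3 * (if t.1 = 1 then op else if t.1 = -1 then om else 0) * (t.2.1 + t.2.2) +
    (if t.1 = 1 then op else if t.1 = -1 then om else 0) * (if t.1 = 1 then op else if t.1 = -1 then om else 0) + 2 * t.1 * t.1

/-- On layers `|k| ≤ 1`, `threeNormSq s k i j = intNormSq (s 0) (−s(−1)) (k, i, j)`. [this file] -/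
theorem threeNormSq_eq_intNormSq (s : ℤ → ℤ) {k : ℤ} (hk : k = 0 ∨ k = 1 ∨ k = -1) (i j : ℤ) :
    threeNormSq s k i j = intNormSq (s 0) (-s (-1)) (k, i, j) := by
  rcases hk with rfl | rfl | rfl
  · simp [threeNormSq, intNormSq]
  · simp [threeNormSq, intNormSq, haggLabel_one_eq]
  · simp [threeNormSq, intNormSq, haggLabel_neg_one_eq]

/-- The layers of the 18 triples are `0, ±1`. [this file] -/
theorem layer_of_mem_twoShellIdx {op om : ℤ} (hop : op = 1 ∨ op = -1) (hom : om = 1 ∨ om = -1) :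
    ∀ t ∈ twoShellIdx op om, t.1 = 0 ∨ t.1 = 1 ∨ t.1 = -1 := by
  rcases hop with rfl | rfl <;> rcases hom with rfl | rfl <;> decide

/-- `3‖p‖² = 3` on the first shell. [this file] -/
theorem intNormSq_first {op om : ℤ} (hop : op = 1 ∨ op = -1) (hom : om = 1 ∨ om = -1) :
    ∀ t ∈ firstShellIdx op om, intNormSq op om t = 3 := by
  rcases hop with rfl | rfl <;> rcases hom with rfl | rfl <;> decide

/-- `3‖p‖² = 6` on the second shell. [this file] -/
theorem intNormSq_second {op om : ℤ} (hop : op = 1 ∨ op = -1) (hom : om = 1 ∨ om = -1) :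
    ∀ t ∈ secondShellIdx op om, intNormSq op om t = 6 := by
  rcases hop with rfl | rfl <;> rcases hom with rfl | rfl <;> decide

/-- The first shell misses the second. [this file] -/
theorem intNormSq_two {op om : ℤ} (hop : op = 1 ∨ op = -1) (hom : om = 1 ∨ om = -1) {t : ℤ × ℤ × ℤ} (ht : t ∈ twoShellIdx op om) :
    intNormSq op om t = 3 ∨ intNormSq op om t = 6 := by
  rcases Finset.mem_union.mp ht with h | h
  · exact Or.inl (intNormSq_first hop hom t h)
  · exact Or.inr (intNormSq_second hop hom t h)

/-! ## The integer case analysis -/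

/-- Centre layer: `3(i² + ij + j²) ≤ 6`, `(i,j) ≠ 0` ⇒ one of the six. [this file] -/
theorem mem_centreShell_of_le {i j : ℤ} (h0 : ¬ (i = 0 ∧ j = 0)) (h : 3 * (i * i + i * j + j * j) ≤ 6) : (0, i, j) ∈ centreShell := by
  have hj : j * j ≤ 3 := by nlinarith [sq_nonneg (2 * i + j)]
  have hi : i * i ≤ 3 := by nlinarith [sq_nonneg (2 * j + i)]
  have hj1 : -1 ≤ j ∧ j ≤ 1 := by constructor <;> nlinarith
  have hi1 : -1 ≤ i ∧ i ≤ 1 := by constructor <;> nlinarith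
  obtain ⟨hi1, hi2⟩ := hi1; obtain ⟨hj1, hj2⟩ := hj1
  interval_cases i <;> interval_cases j <;> first | (exfalso; omega) | decide

/-- Adjacent layer with label `o = ±1`: `3(i² + ij + j²) + 3o(i + j) + o² + 2 ≤ 6` ⇒ one of the six of that layer. [this file] -/
theorem mem_shellLayer_of_le {o i j : ℤ} (ho : o = 1 ∨ o = -1) (k : ℤ) (h : 3 * (i * i + i * j + j * j) + 3 * o * (i + j) + o * o + 2 ≤ 6) :
    (k, i, j) ∈ firstShellLayer k o ∪ secondShellLayer k o := by
  rcases ho with rfl | rfl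
  · have hj : j * j ≤ 3 := by nlinarith [sq_nonneg (2 * i + j + 1), sq_nonneg (j - 1), sq_nonneg (j + 1)]
    have hi : i * i ≤ 3 := by nlinarith [sq_nonneg (2 * j + i + 1), sq_nonneg (i - 1), sq_nonneg (i + 1)]
    have hj1 : -1 ≤ j ∧ j ≤ 1 := by constructor <;> nlinarith
    have hi1 : -1 ≤ i ∧ i ≤ 1 := by constructor <;> nlinarith
    obtain ⟨hi1, hi2⟩ := hi1; obtain ⟨hj1, hj2⟩ := hj1
    interval_cases i <;> interval_cases j <;> first | (exfalso; omega) | simp [firstShellLayer, secondShellLayer]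
  · have hj : j * j ≤ 3 := by nlinarith [sq_nonneg (2 * i + j - 1), sq_nonneg (j - 1), sq_nonneg (j + 1)]
    have hi : i * i ≤ 3 := by nlinarith [sq_nonneg (2 * j + i - 1), sq_nonneg (i - 1), sq_nonneg (i + 1)]
    have hj1 : -1 ≤ j ∧ j ≤ 1 := by constructor <;> nlinarith
    have hi1 : -1 ≤ i ∧ i ≤ 1 := by constructor <;> nlinarith
    obtain ⟨hi1, hi2⟩ := hi1; obtain ⟨hj1, hj2⟩ := hj1
    interval_cases i <;> interval_cases j <;> first | (exfalso; omega) | simp [firstShellLayer, secondShellLayer]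

/-- ★ Every nonzero index triple with `3‖p‖² ≤ 6` is one of the 18 two-shell triples of the window. [this file] -/
theorem mem_twoShellIdx_of_threeNormSq_le_six {s : ℤ → ℤ} (hs : IsHaggSeq s) {k i j : ℤ} (h0 : ¬ (k = 0 ∧ i = 0 ∧ j = 0))
    (h6 : threeNormSq s k i j ≤ 6) : (k, i, j) ∈ twoShellIdx (s 0) (-s (-1)) := by
  have hX : 0 ≤ 3 * (i * i + i * j + j * j) + 3 * haggLabel s k * (i + j) + haggLabel s k * haggLabel s k := by
    nlinarith [sq_nonneg (2 * i + j + haggLabel s k), sq_nonneg (3 * j + haggLabel s k)]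
  unfold threeNormSq at h6
  rcases (by omega : k = 0 ∨ k = 1 ∨ k = -1 ∨ (k ≤ -2 ∨ 2 ≤ k)) with rfl | rfl | rfl | hk
  · have hij : ¬ (i = 0 ∧ j = 0) := fun h => h0 ⟨rfl, h⟩
    simp only [haggLabel_zero] at h6
    have hc := mem_centreShell_of_le hij (by linarith)
    simp [twoShellIdx, firstShellIdx, hc]
  · rw [haggLabel_one_eq] at h6
    have h := mem_shellLayer_of_le (hs 0) 1 (by nlinarith [h6])
    rcases Finset.mem_union.mp h with h | h
    · simp [twoShellIdx, firstShellIdx, h]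
    · simp [twoShellIdx, secondShellIdx, h]
  · rw [haggLabel_neg_one_eq] at h6
    have ho : -s (-1) = 1 ∨ -s (-1) = -1 := by rcases hs (-1) with h | h <;> omega
    have h := mem_shellLayer_of_le ho (-1) (by nlinarith [h6])
    rcases Finset.mem_union.mp h with h | h
    · simp [twoShellIdx, firstShellIdx, h]
    · simp [twoShellIdx, secondShellIdx, h]
  · exfalso
    have hk2 : 4 ≤ k * k := by rcases hk with hk | hk <;> nlinarith
    nlinarith

/-! ## The two shells and the first shell of a chart -/

/-- The labels of a Hägg sequence at `±1` are signs. [this file] -/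
theorem labels_sign {s : ℤ → ℤ} (hs : IsHaggSeq s) : (s 0 = 1 ∨ s 0 = -1) ∧ (-s (-1) = 1 ∨ -s (-1) = -1) :=
  ⟨hs 0, by rcases hs (-1) with h | h <;> omega⟩

/-- `3‖idxPos s t‖² = intNormSq` on the 18 triples. [this file] -/
theorem three_mul_norm_sq_idxPos {s : ℤ → ℤ} (hs : IsHaggSeq s) {t : ℤ × ℤ × ℤ} (ht : t ∈ twoShellIdx (s 0) (-s (-1))) :
    3 * ‖idxPos s t‖ ^ 2 = (intNormSq (s 0) (-s (-1)) t : ℝ) := by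
  obtain ⟨hop, hom⟩ := labels_sign hs
  rw [idxPos, three_mul_norm_sq_barlowPos, threeNormSq_eq_intNormSq s (layer_of_mem_twoShellIdx hop hom t ht)]

/-- ★ **The two shells are window data**: `p ∈ twoShellRef s` iff `p` is the structure point of one of the 18 triples `twoShellIdx (s 0) (−s(−1))`. [this file] -/
theorem mem_twoShellRef_iff {s : ℤ → ℤ} (hs : IsHaggSeq s) {p : E3} :
    p ∈ twoShellRef s ↔ ∃ t ∈ twoShellIdx (s 0) (-s (-1)), p = idxPos s t := by
  obtain ⟨hop, hom⟩ := labels_sign hs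
  constructor
  · rintro ⟨⟨k, i, j, rfl⟩, hp0, hle⟩
    refine ⟨(k, i, j), mem_twoShellIdx_of_threeNormSq_le_six hs (indices_ne_zero_of_barlowPos_ne_zero hp0) ?_, rfl⟩
    have hT := three_mul_norm_sq_barlowPos s k i j
    have hn := norm_nonneg (barlowPos 1 (Real.sqrt (2 / 3)) s k i j)
    have h7 : (threeNormSq s k i j : ℝ) < 7 := by nlinarith
    have h7' : threeNormSq s k i j < 7 := by exact_mod_cast h7
    omega
  · rintro ⟨t, ht, rfl⟩
    have h3 := three_mul_norm_sq_idxPos hs ht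
    have h36 := intNormSq_two hop hom ht
    have hsq : ‖idxPos s t‖ ^ 2 = 1 ∨ ‖idxPos s t‖ ^ 2 = 2 := by
      rcases h36 with h | h
      · left; have : (intNormSq (s 0) (-s (-1)) t : ℝ) = 3 := by exact_mod_cast h
        linarith
      · right; have : (intNormSq (s 0) (-s (-1)) t : ℝ) = 6 := by exact_mod_cast h
        linarith
    have hn := norm_nonneg (idxPos s t)
    refine ⟨barlowPos_mem _ _ _, ?_, ?_⟩
    · intro h0
      rw [h0, norm_zero] at hsq; norm_num at hsq
    · show ‖idxPos s t‖ ≤ 3 / 2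
      rcases hsq with h | h <;> nlinarith

/-- ★ **The first shell is window data**: `‖barlowPos 1 √(2/3) s k i j‖ = 1` iff `(k,i,j)` is one of the 12 first-shell triples. [this file] -/
theorem norm_barlowPos_eq_one_iff_firstShell {s : ℤ → ℤ} (hs : IsHaggSeq s) (k i j : ℤ) :
    ‖barlowPos 1 (Real.sqrt (2 / 3)) s k i j‖ = 1 ↔ (k, i, j) ∈ firstShellIdx (s 0) (-s (-1)) := by
  obtain ⟨hop, hom⟩ := labels_sign hs
  have hT := three_mul_norm_sq_barlowPos s k i j
  constructor
  · intro h1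
    rw [h1] at hT
    have h3 : threeNormSq s k i j = 3 := by exact_mod_cast (by linarith : (threeNormSq s k i j : ℝ) = 3)
    have h0 : ¬ (k = 0 ∧ i = 0 ∧ j = 0) := by
      rintro ⟨rfl, rfl, rfl⟩; simp [threeNormSq] at h3
    have hmem := mem_twoShellIdx_of_threeNormSq_le_six hs h0 (by omega)
    have hk : k = 0 ∨ k = 1 ∨ k = -1 := layer_of_mem_twoShellIdx hop hom _ hmem
    rcases Finset.mem_union.mp hmem with h | h
    · exact h
    · exfalso
      have h6 := intNormSq_second hop hom _ h
      rw [threeNormSq_eq_intNormSq s hk i j] at h3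
      omega
  · intro h
    have hmem : (k, i, j) ∈ twoShellIdx (s 0) (-s (-1)) := Finset.mem_union_left _ h
    have hk : k = 0 ∨ k = 1 ∨ k = -1 := layer_of_mem_twoShellIdx hop hom _ hmem
    have h3 := intNormSq_first hop hom _ h
    rw [threeNormSq_eq_intNormSq s hk i j, h3] at hT
    have hn := norm_nonneg (barlowPos 1 (Real.sqrt (2 / 3)) s k i j)
    push_cast at hT
    nlinarith

/-- First-shell triples are nonzero unit structure points. [this file] -/
theorem idxPos_first {s : ℤ → ℤ} (hs : IsHaggSeq s) {t : ℤ × ℤ × ℤ} (ht : t ∈ firstShellIdx (s 0) (-s (-1))) :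
    idxPos s t ∈ barlowStacking 1 (Real.sqrt (2 / 3)) s ∧ idxPos s t ≠ 0 ∧ ‖idxPos s t‖ = 1 := by
  have h1 : ‖idxPos s t‖ = 1 := (norm_barlowPos_eq_one_iff_firstShell hs t.1 t.2.1 t.2.2).2 ht
  exact ⟨barlowPos_mem _ _ _, fun h0 => by rw [h0, norm_zero] at h1; exact zero_ne_one h1, h1⟩

/-- ★ **The nearest distance is window data**: for `X` within `m ≤ 1/6` of a linear isometry, `μ` is the attained minimum of `‖X p‖` over the nonzero
structure points iff it is the attained minimum over the 12 first-shell points of the window (first shell wins, `norm_map_first_shell_le`). [this file] -/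
theorem nearest_iff_firstShell {s : ℤ → ℤ} (hs : IsHaggSeq s) {X : E3 →ₗ[ℝ] E3} {m : ℝ} (hm : m ≤ 1 / 6)
    (hX : ∃ Q : E3 →ₗᵢ[ℝ] E3, ∀ v : E3, ‖X v - Q v‖ ≤ m * ‖v‖) (μ : ℝ) :
    ((∀ p ∈ barlowStacking 1 (Real.sqrt (2 / 3)) s, p ≠ 0 → μ ≤ ‖X p‖) ∧
        ∃ p ∈ barlowStacking 1 (Real.sqrt (2 / 3)) s, p ≠ 0 ∧ μ = ‖X p‖) ↔
      ((∀ t ∈ firstShellIdx (s 0) (-s (-1)), μ ≤ ‖X (idxPos s t)‖) ∧ ∃ t ∈ firstShellIdx (s 0) (-s (-1)), μ = ‖X (idxPos s t)‖) := by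
  constructor
  · rintro ⟨hle, p, hp, hp0, hpeq⟩
    refine ⟨fun t ht => ?_, ?_⟩
    · obtain ⟨hm1, hm0, _⟩ := idxPos_first hs ht
      exact hle _ hm1 hm0
    · by_cases h1 : ‖p‖ = 1
      · obtain ⟨k, i, j, rfl⟩ := hp
        exact ⟨(k, i, j), (norm_barlowPos_eq_one_iff_firstShell hs k i j).1 h1, hpeq⟩
      · -- first shell wins: any unit structure point does at least as well
        have h0mem : ((0 : ℤ), (1 : ℤ), (0 : ℤ)) ∈ firstShellIdx (s 0) (-s (-1)) := by simp [firstShellIdx, centreShell]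
        obtain ⟨hm1, hm0, hn1⟩ := idxPos_first hs h0mem
        refine ⟨(0, 1, 0), h0mem, le_antisymm (hle _ hm1 hm0) ?_⟩
        rw [hpeq]
        exact norm_map_first_shell_le hs hm hX hn1 hp hp0 h1
  · rintro ⟨hle, t, ht, hteq⟩
    obtain ⟨hm1, hm0, hn1⟩ := idxPos_first hs ht
    refine ⟨fun p hp hp0 => ?_, idxPos s t, hm1, hm0, hteq⟩
    by_cases h1 : ‖p‖ = 1
    · obtain ⟨k, i, j, rfl⟩ := hp
      exact hle (k, i, j) ((norm_barlowPos_eq_one_iff_firstShell hs k i j).1 h1)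
    · rw [hteq]; exact norm_map_first_shell_le hs hm hX hn1 hp hp0 h1

/-- Pin: the hcp-type window (`s 0 = 1`, `s(−1) = −1`, labels `(1, 1)`) has these 18 triples; `decide`d cardinalities `12 + 6`. -/
example : (firstShellIdx 1 1).card = 12 ∧ (secondShellIdx 1 1).card = 6 ∧ (twoShellIdx 1 1).card = 18 := by decide
/-- Pin: the fcc-type window (labels `(1, −1)`). -/
example : (firstShellIdx 1 (-1)).card = 12 ∧ (secondShellIdx 1 (-1)).card = 6 ∧ (twoShellIdx 1 (-1)).card = 18 := by decide

end Summit.AtomisticToContinuum.Crystallization.Theorems.OverbindingBudgetAffineFarSmoothSplit
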